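import Literature.NumberTheory.GaloisRepresentations.ContinuousCorestriction
import HarnessLib

/-!
# Corestriction is invariant under the conjugation action: `cor ∘ (g · ) = cor` on `H¹(N, X)`

Topic `NumberTheory/GaloisRepresentations`; namespace `Literature.NumberTheory.GaloisRepresentations`.
Cell `bsd-smallim` (rung K6 of `BirchSwinnertonDyer`, crux `MuTransferX9` = item 19276), seat
`bsd-smallim-k6-ty` (typer): the generic ingredient of the `γ ↔ 1 + S` entry of the Shapiro dictionary
(`IwasawaTwistModPShapiroCores.lean`: `coresShapiro n = cor_{Γ_n}^{Γ_K} ∘ H¹(m ↦ m·T⁰)`), namely that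
the explicit corestriction `cores : H¹(N, X) → H¹(G, X)` of `ContinuousCorestriction.lean` (transfer on
continuous crossed homomorphisms, `N` open normal of finite index) is invariant under the action
`conjMap X N g 1` of `g ∈ G` on `H¹(N, X)`.  PROOFS only; no definition of substance, no fact.

* `oneCocycleClass_eq_of_conj` — **inner automorphisms act trivially on `H¹(G, X)`**: a crossed
  homomorphism `k ↦ g • ψ(g⁻¹ k g)` is cohomologous to `ψ` (`g•ψ(g⁻¹kg) − ψ(k) = k•ψ(g) − ψ(g)`).
* `conjSection` — the system of representatives `s_g(x) = g⁻¹ s(ḡ x ḡ⁻¹) g` of `G ⧸ N` conjugate to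
  `s`, and `transferFun_conj`: **`transfer_s(g · φ)(h) = g • transfer_{s_g}(φ)(g⁻¹ h g)`** (termwise
  under the reindexing `x ↦ ḡ x ḡ⁻¹` of `G ⧸ N`).
* **`cores_conjMap`**: `cores X N hN (conjMap X N g 1 c) = cores X N hN c` for every `g ∈ G`
  ("`cor` commutes with conjugation, which is the identity on `H¹(G, ·)`").

## References

* J. Neukirch, A. Schmidt, K. Wingberg, *Cohomology of Number Fields* (2008), I §5 (Prop. 1.5.4:
  `cor` and `res` commute with conjugation `σ_*`; (1.6.3): inner automorphisms act trivially).
  [NeukirchSchmidtWingberg2008]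
* J.-P. Serre, *Local Fields* (1979), VII §5 (Prop. 3) and VII §7–§8 (the transfer); *Galois
  Cohomology* (1997), I §2.4–§2.5. [SerreGaloisCohomology1997]
-/

noncomputable section

open CategoryTheory

universe u v

namespace Literature.NumberTheory.GaloisRepresentations

open Literature.NumberTheory.EllipticCurves (schreierElt schreierElt_mem schreierElt_coe
  subgroupConj subgroupConj_apply_coe conj_mem_of_normal)

variable {R : Type u} [Ring R] [TopologicalSpace R]
variable {G : Type v} [Group G] [TopologicalSpace G] [IsTopologicalGroup G]
variable (X : TopRep.{v} R G)

/-! ## Inner automorphisms act trivially on `H¹(G, X)` -/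

/-- **Inner automorphisms act trivially on `H¹(G, X)`.**  If `ψ'(k) = g • ψ(g⁻¹ k g)` for a continuous
crossed homomorphism `ψ` on `G`, then `[ψ'] = [ψ]`: indeed `g•ψ(g⁻¹ k g) − ψ(k) = k•ψ(g) − ψ(g)` is the
coboundary of `ψ(g)`. [cite: NeukirchSchmidtWingberg2008, (1.6.3)] -/
theorem oneCocycleClass_eq_of_conj (g : G) (ψ ψ' : contOneCocycles X)
    (h : ∀ k, ψ'.1 k = X.ρ g (ψ.1 (g⁻¹ * k * g))) : oneCocycleClass X ψ' = oneCocycleClass X ψ := by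
  rw [← sub_eq_zero, ← oneCocycleClass_sub, oneCocycleClass_eq_zero_iff]
  refine ⟨ψ.1 g, fun k ↦ ?_⟩
  have hinv : X.ρ g (ψ.1 g⁻¹) = -ψ.1 g := by
    have h1 := ψ.2 g g⁻¹
    rw [mul_inv_cancel, contOneCocycles.apply_one] at h1
    rw [eq_neg_iff_add_eq_zero, add_comm]
    exact h1.symm
  rw [Submodule.coe_sub, ContinuousMap.sub_apply, h k, ψ.2 (g⁻¹ * k) g, ψ.2 g⁻¹ k, map_add, map_add,
    hinv, ρ_apply_ρ_inv_apply, ← ρ_mul_apply, ← mul_assoc, mul_inv_cancel, one_mul]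
  abel

/-! ## The conjugate system of representatives and the transfer of a conjugated cocycle -/

section Conj

variable (N : Subgroup G) [N.Normal] [Fintype (G ⧸ N)] {s : G ⧸ N → G}

/-- The system of representatives of `G ⧸ N` conjugate to `s` by `g`:
`s_g(x) = g⁻¹ · s(ḡ x ḡ⁻¹) · g` (`ḡ` the class of `g` in the group `G ⧸ N`).
[cite: NeukirchSchmidtWingberg2008, I §5] -/
def conjSection (s : G ⧸ N → G) (g : G) (x : G ⧸ N) : G :=
  g⁻¹ * s ((g : G ⧸ N) * x * (g : G ⧸ N)⁻¹) * g

omit [TopologicalSpace G] [IsTopologicalGroup G] [Fintype (G ⧸ N)] in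
/-- `s_g` is a system of representatives when `s` is. [cite: NeukirchSchmidtWingberg2008, I §5] -/
theorem conjSection_spec (hs : ∀ x : G ⧸ N, (s x : G ⧸ N) = x) (g : G) (x : G ⧸ N) :
    ((conjSection N s g x : G) : G ⧸ N) = x := by
  rw [conjSection, QuotientGroup.mk_mul, QuotientGroup.mk_mul, QuotientGroup.mk_inv, hs]
  group

omit [TopologicalSpace G] [IsTopologicalGroup G] [Fintype (G ⧸ N)] in
/-- The action of `G` on `G ⧸ N` is left multiplication by the class: `a • x = ā x`. [folklore] -/
private theorem smul_eq_mk_mul (a : G) (x : G ⧸ N) : a • x = (a : G ⧸ N) * x := by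
  induction x using QuotientGroup.induction_on with
  | H b => rw [MulAction.Quotient.smul_coe, smul_eq_mul, QuotientGroup.mk_mul]

omit [TopologicalSpace G] [IsTopologicalGroup G] [Fintype (G ⧸ N)] in
/-- `s_g((g⁻¹ h g) • x) = g⁻¹ · s(h • ḡ x ḡ⁻¹) · g`. [folklore] -/
private theorem conjSection_smul (g h : G) (x : G ⧸ N) :
    conjSection N s g ((g⁻¹ * h * g) • x) =
      g⁻¹ * s (h • ((g : G ⧸ N) * x * (g : G ⧸ N)⁻¹)) * g := by
  rw [conjSection, smul_eq_mk_mul, smul_eq_mk_mul, QuotientGroup.mk_mul, QuotientGroup.mk_mul,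
    QuotientGroup.mk_inv]
  congr 2
  group

omit [Fintype (G ⧸ N)] in
/-- The Schreier elements of `g⁻¹ h g` for `s_g` are the `g`-conjugates of those of `h` for `s`:
`s_g((g⁻¹hg)•x)⁻¹ (g⁻¹hg) s_g(x) = g⁻¹ · (s(h•y)⁻¹ h s(y)) · g`, `y = ḡ x ḡ⁻¹`. [folklore] -/
private theorem schreierElt_conjSection (hs : ∀ x : G ⧸ N, (s x : G ⧸ N) = x) (g h : G)
    (x : G ⧸ N) :
    schreierElt N (conjSection_spec N hs g) (g⁻¹ * h * g) x =
      subgroupConj N g (schreierElt N hs h ((g : G ⧸ N) * x * (g : G ⧸ N)⁻¹)) := by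
  apply Subtype.ext
  rw [schreierElt_coe, subgroupConj_apply_coe, schreierElt_coe, conjSection_smul]
  rw [conjSection]
  group

/-- **The transfer of a conjugated cocycle**: for a crossed homomorphism `φ` on `N` and `g ∈ G`,
`transfer_s(g · φ)(h) = g • transfer_{s_g}(φ)(g⁻¹ h g)`, where `(g · φ)(n) = g • φ(g⁻¹ n g)` and
`s_g` is the conjugate system of representatives (termwise identity after reindexing the cosets by
`x ↦ ḡ x ḡ⁻¹`). [cite: NeukirchSchmidtWingberg2008, Prop. 1.5.4] -/
theorem transferFun_conj (hs : ∀ x : G ⧸ N, (s x : G ⧸ N) = x) (g : G)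
    (φ : contOneCocycles (subgroupRep X N)) (h : G) :
    transferFun X N hs (contOneCocycles.pullback (subgroupConj N g) (conjRepHom X N g) φ) h =
      X.ρ g (transferFun X N (conjSection_spec N hs g) φ (g⁻¹ * h * g)) := by
  classical
  rw [transferFun_apply, transferFun_apply, map_sum]
  -- reindex the right-hand sum by `x ↦ ḡ x ḡ⁻¹`
  let e : G ⧸ N ≃ G ⧸ N := (MulAut.conj (g : G ⧸ N)).toEquiv
  refine (Fintype.sum_equiv e _ _ fun x ↦ ?_).symm
  have he : e x = (g : G ⧸ N) * x * (g : G ⧸ N)⁻¹ := rfl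
  rw [he, conj_pullback_apply, conjSection_smul, schreierElt_conjSection N hs g h x, ← ρ_mul_apply,
    ← mul_assoc, ← mul_assoc, mul_inv_cancel, one_mul, ρ_mul_apply]

/-- **Corestriction is invariant under conjugation**: `cor (g · c) = cor c` for the explicit
corestriction `cores : H¹(N, X) → H¹(G, X)` (`N` open normal of finite index) and the action
`conjMap X N g 1` of `g ∈ G` on `H¹(N, X)` — `cor` commutes with `σ_*` and `σ_*` is the identity on
`H¹(G, X)`. [cite: NeukirchSchmidtWingberg2008, Prop. 1.5.4 and (1.6.3)] -/
theorem cores_conjMap (hN : IsOpen (N : Set G)) (g : G)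
    (c : continuousCohomology 1 (subgroupRep X N)) :
    cores X N hN (conjMap X N g 1 c) = cores X N hN c := by
  classical
  obtain ⟨φ, rfl⟩ := oneCocycleClass_surjective _ c
  have hs : ∀ x : G ⧸ N, ((Quotient.out x : G) : G ⧸ N) = x := QuotientGroup.out_eq'
  rw [conjMap_oneCocycleClass, cores_oneCocycleClass X N hN hs,
    cores_oneCocycleClass X N hN (conjSection_spec N hs g)]
  refine oneCocycleClass_eq_of_conj X g _ _ fun k ↦ ?_
  rw [transferCocycle_apply, transferCocycle_apply]
  exact transferFun_conj X N hs g φ k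

end Conj

end Literature.NumberTheory.GaloisRepresentations

end
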